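import Summits.BirchSwinnertonDyer.BirchSwinnertonDyer.Theorems.Rank2ObservatoryPadicSymbolTableL
import Summits.BirchSwinnertonDyer.BirchSwinnertonDyer.Theorems.Rank2ObservatoryRank2Table
import Literature.NumberTheory.Sieve.GoldbachLinnikDirectMeanCert
import HarnessLib

/-!
# BirchSwinnertonDyer — rank ≥ 2 observatory: the `p`-adic atlas kit (one kernel test per census cell)

HONEST FRAMING: per-curve certified theorems and census instruments; no claim on BSD in rank ≥ 2.

Module of the series `Rank2ObservatoryPadic*.lean` (generic squeeze `Rank2ObservatoryPadicRow.lean`,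
symbol tables `Rank2ObservatoryPadicSymbolTable(L).lean`). It packages EVERYTHING the kernel checks
about one two-engine cell `(E, p)` of the rank-2 `p`-adic census into ONE Boolean, so that the
machine-written atlas files `Rank2ObservatoryPadicAtlasR2A*.lean` are pure data plus one `decide`:

* `AtlasCell = (p, a_p, n, A, tabHi, tabLo, H, L)` — the level-`p^{n+1}` symbol-table certificate of
  the cell in the shape of `SymbolCertL` (`r = 2`), with the period-`p^n` table `tabLo` stored ONCE per
  residue `u mod p^n` (`AtlasCell.certL` expands it; `[u/p^n]⁺` only depends on `u mod p^n`);
* `AtlasCell.check e c` (for the curve's integer model `e`): `p` prime (trial division `primeB`),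
  `p ≥ 5`, `p ∤ Δ(e)`, the point count `#Ẽ(𝔽_p) = p + 1 − a_p` by the Euler criterion
  (`eulerAffineCount`, the sum of `card_sol_eq_sum_euler` made computable), `p ∤ a_p` (ORDINARY), and
  `SymbolCertL.validL p a_p` of the expanded certificate;
* `AtlasCurve = (row, B, cells)` — a row of the rank-2 census (`Rank2Row`, verbatim, so that the rank
  hypothesis `hlow : 2 ≤ rank row.curve` is literally the one discharged by the kernel certificates
  `Rank2ObservatoryKernelCerts*.lean`), a bound `B` for the finite global-minimality criterion
  (`|Δ| < B¹²` and `q¹² ∤ Δ ∨ q ∤ c₄` for all `q < B`; `forall_not_pow_dvd_or_of_bound`), and its cells;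
  `AtlasCurve.check` = `Δ ≠ 0` and every cell checks; `AtlasCurve.minCheck` = the minimality criterion.

SOUNDNESS (`AtlasCurve.padicRow`): if `C.check = true` and `c ∈ C.cells` then — GIVEN the named
hypotheses of the series (`hPRS` Perrin-Riou–Schneider as in BMS Thm. 1.7, `hkato` Kato Thm. 17.4 for
all cyclotomic data, the newform `hf`, the census rank certificate `hlow`, and the symbol DATA
`hint`/`htab`: the plus symbols of `f` are `p`-integral and the tabulated numerators ARE
`D·[u/p^{n+1}]⁺`, `D·[u/p^n]⁺` for a `p`-unit `D`) — `rank_ℤ E(ℚ) = 2`, `ord_{T=0} L_p(E,T) = 2`,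
`Ш(E/ℚ)[p^∞]` is finite, every canonical `p`-adic height datum is non-degenerate (Schneider at
`(E,p)`), and `corank Sel_{p^∞}(E/ℚ) = 2`. The instance hypotheses `[Fact p.Prime]`,
`[IsElliptic]`, `[IsGloballyMinimal]` of the statement are discharged by `AtlasCell.prime_of_check`,
`AtlasCurve.isElliptic`, `AtlasCurve.isGloballyMinimal` (the last from `minCheck`; for the few census
curves whose minimal model has `2¹² ∣ Δ` and `2 ∣ c₄` the criterion is silent and global minimality of
Cremona's model stays a hypothesis of the row). Nothing here is specific to a curve; no `sorry`, no
new axioms, kernel `decide` only (no `native_decide`).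

References: B. Mazur, J. Tate, J. Teitelbaum, Invent. Math. 84 (1986), §I.10–I.13; W. Stein,
C. Wuthrich, Math. Comp. 82 (2013), §3; J. Balakrishnan, J. S. Müller, W. Stein, Math. Comp. 85 (2016),
Thm. 1.7; K. Kato, Astérisque 295 (2004), Thm. 17.4; J. Silverman, AEC (2009), VII.1, VIII.8;
J. Cremona, Algorithms for Modular Elliptic Curves (1997), §2.13, §3.5.
-/

-- single-conjunct summit: `Summit.BirchSwinnertonDyer.BirchSwinnertonDyer.…` repeats the name by design
set_option linter.dupNamespace false

namespace Summit.BirchSwinnertonDyer.BirchSwinnertonDyer.Rank2Observatory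

open scoped MatrixGroups ModularForm
open CongruenceSubgroup Literature.NumberTheory.EllipticCurves
  Literature.NumberTheory.EllipticCurves.ModularForms WeierstrassCurve

/-! ### Kernel primitives: trial-division primality (reused) and the Euler-criterion point count -/

-- Trial-division primality `primeB` and its soundness `prime_of_primeB` are REUSED from the tree
-- (`Literature.NumberTheory.Sieve.GoldbachLinnik`, same kernel-evaluable Boolean; gate dedup).
open Literature.NumberTheory.Sieve.GoldbachLinnik (primeB prime_of_primeB)

/-- The Euler-criterion count of affine solutions of a Weierstrass equation over `ℤ/p` (computable;
the right-hand side of the tree's `card_sol_eq_sum_euler` at `F = ZMod p`): for each `x`, the number of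
`y` with `y² + a₁xy + a₃y = x³ + a₂x² + a₄x + a₆` is `1`, `2` or `0` according as the discriminant
`d(x) = (a₁x + a₃)² + 4(x³ + a₂x² + a₄x + a₆)` is `0`, a non-zero square (`d^{(p−1)/2} = 1`), or not.
[folklore] -/
def eulerAffineCount (p : ℕ) (a₁ a₂ a₃ a₄ a₆ : ZMod p) : ℕ :=
  if h : p = 0 then 0 else
    haveI : NeZero p := ⟨h⟩
    ∑ x : ZMod p, if (a₁ * x + a₃) ^ 2 + 4 * (x ^ 3 + a₂ * x ^ 2 + a₄ * x + a₆) = 0 then 1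
      else if ((a₁ * x + a₃) ^ 2 + 4 * (x ^ 3 + a₂ * x ^ 2 + a₄ * x + a₆)) ^ (p / 2) = 1 then 2 else 0

/-- **`#W(𝔽_p) = 1 + eulerAffineCount`** for a non-singular Weierstrass curve over `ℤ/p`, `p` an odd
prime (the tree's `natCard_point_eq_one_add_card` and `card_sol_eq_sum_euler`). [folklore] -/
theorem natCard_point_eq_one_add_eulerAffineCount (p : ℕ) [Fact p.Prime] (hp2 : p ≠ 2)
    (W : WeierstrassCurve (ZMod p)) (hΔ : W.Δ ≠ 0) :
    Nat.card W.toAffine.Point = 1 + eulerAffineCount p W.a₁ W.a₂ W.a₃ W.a₄ W.a₆ := by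
  rw [natCard_point_eq_one_add_card W hΔ,
    card_sol_eq_sum_euler (by rw [ZMod.ringChar_zmod_n]; exact hp2) W, ZMod.card, eulerAffineCount,
    dif_neg (Fact.out : p.Prime).ne_zero]

/-! ### One cell: the certificate datum and its kernel test -/

/-- The certificate datum of ONE two-engine cell `(E, p)` of the rank-2 `p`-adic census: the prime
`p`, the Frobenius trace `a_p`, the level `n` (Riemann sum at measure level `p^{n+1}`), an integer
`A ≡ α_p (mod p^n)`, the numerators `tabHi[u]` of `D·[u/p^{n+1}]⁺` (`u < p^{n+1}`, `0` at non-units),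
the numerators `tabLo[v]` of `D·[v/p^n]⁺` (`v < p^n`; the value at `u` is read at `u mod p^n`), and the
claimed double sums `H = ΣHi`, `L = ΣLo`. [cite: MazurTateTeitelbaum1986Invent, §I.10–I.13] -/
structure AtlasCell where
  /-- the good ordinary prime `p ≥ 5` -/
  p : ℕ
  /-- the Frobenius trace `a_p = p + 1 − #Ẽ(𝔽_p)` -/
  ap : ℤ
  /-- the level: Riemann sum at measure level `p^{n+1}` -/
  n : ℕ
  /-- an integer congruent to the unit root `α_p` modulo `p^n` -/
  A : ℤ
  /-- numerators of `D·[u/p^{n+1}]⁺`, `u = 0 … p^{n+1} − 1` -/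
  tabHi : List ℤ
  /-- numerators of `D·[v/p^n]⁺`, `v = 0 … p^n − 1` -/
  tabLo : List ℤ
  /-- the integer double sum `ΣHi` -/
  H : ℤ
  /-- the integer double sum `ΣLo` -/
  L : ℤ

namespace AtlasCell

variable (c : AtlasCell)

/-- The cell's `SymbolCertL` (`r = 2`), with the period-`p^n` table expanded to length `p^{n+1}`.
[folklore] -/
def certL : SymbolCertL :=
  ⟨2, c.n, c.A, c.tabHi, (List.range (c.p ^ (c.n + 1))).map fun u => c.tabLo.getD (u % c.p ^ c.n) 0,
    c.H, c.L⟩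

/-- Reading the expanded table: entry `u < p^{n+1}` is `tabLo[u mod p^n]`. [folklore] -/
theorem certL_tabLo_getD {u : ℕ} (hu : u < c.p ^ (c.n + 1)) :
    c.certL.tabLo.getD u 0 = c.tabLo.getD (u % c.p ^ c.n) 0 := by
  simp [certL, List.getD, List.getElem?_range hu]

/-- The kernel point count `#Ẽ(𝔽_p) = 1 + eulerAffineCount` of the integer model `e` at the cell's
prime. [folklore] -/
def count (e : WeierstrassCurve ℤ) : ℕ :=
  1 + eulerAffineCount c.p e.a₁ e.a₂ e.a₃ e.a₄ e.a₆

/-- **The kernel test of a cell** against the curve's integer model `e`: `p` prime, `p ≥ 5`, `p ∤ Δ(e)`,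
`#Ẽ(𝔽_p) = p + 1 − a_p`, `p ∤ a_p`, and `validL p a_p` of the expanded certificate (the primality
witness feeds the `Fact p.Prime` instance the test needs). [folklore] -/
def check (e : WeierstrassCurve ℤ) : Bool :=
  decide (5 ≤ c.p) && decide (¬ ((c.p : ℤ) ∣ e.Δ)) && decide ((c.count e : ℤ) = c.p + 1 - c.ap) &&
    decide (¬ ((c.p : ℤ) ∣ c.ap)) &&
    if hp : primeB c.p = true then @SymbolCertL.validL c.p ⟨prime_of_primeB hp⟩ c.ap c.certL else false

section Soundness

variable {c} {e : WeierstrassCurve ℤ} (h : c.check e = true)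
include h

/-- A checking cell's `p` is prime. [folklore] -/
theorem prime_of_check : c.p.Prime := by
  simp only [check, Bool.and_eq_true] at h
  by_cases hp : primeB c.p = true
  · exact prime_of_primeB hp
  · rw [dif_neg hp] at h; exact absurd h.2 Bool.false_ne_true

/-- A checking cell has `5 ≤ p`. [folklore] -/
theorem five_le_of_check : 5 ≤ c.p := by
  simp only [check, Bool.and_eq_true, decide_eq_true_eq] at h
  exact h.1.1.1.1

/-- A checking cell has `p ∤ Δ(e)`. [folklore] -/
theorem not_dvd_Δ_of_check : ¬ ((c.p : ℤ) ∣ e.Δ) := by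
  simp only [check, Bool.and_eq_true, decide_eq_true_eq] at h
  exact h.1.1.1.2

/-- A checking cell's point count: `#Ẽ(𝔽_p) = p + 1 − a_p` (as integers). [folklore] -/
theorem count_eq_of_check : (c.count e : ℤ) = c.p + 1 - c.ap := by
  simp only [check, Bool.and_eq_true, decide_eq_true_eq] at h
  exact h.1.1.2

/-- A checking cell has `p ∤ a_p`. [folklore] -/
theorem not_dvd_ap_of_check : ¬ ((c.p : ℤ) ∣ c.ap) := by
  simp only [check, Bool.and_eq_true, decide_eq_true_eq] at h
  exact h.1.2

/-- A checking cell's expanded certificate is `validL`. [folklore] -/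
theorem validL_of_check [Fact c.p.Prime] : c.certL.validL c.p c.ap = true := by
  simp only [check, Bool.and_eq_true] at h
  by_cases hp : primeB c.p = true
  · have h2 := h.2
    rw [dif_pos hp] at h2
    exact h2
  · rw [dif_neg hp] at h; exact absurd h.2 Bool.false_ne_true

/-- A checking cell's kernel point count IS `#Ẽ(𝔽_p)` of the reduction of `e`. [folklore] -/
theorem card_of_check [Fact c.p.Prime] :
    Nat.card ((e.map (Int.castRingHom (ZMod c.p))).toAffine.Point) = c.count e := by
  have hp2 : c.p ≠ 2 := by have := five_le_of_check h; omega
  have hΔ : (e.map (Int.castRingHom (ZMod c.p))).Δ ≠ 0 := by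
    rw [WeierstrassCurve.map_Δ, eq_intCast, ne_eq, ZMod.intCast_zmod_eq_zero_iff_dvd]
    exact not_dvd_Δ_of_check h
  rw [natCard_point_eq_one_add_eulerAffineCount c.p hp2 _ hΔ]
  rfl

/-- A checking cell's `a_p` IS the Frobenius trace of `e ⊗ ℚ` at `p`. [folklore] -/
theorem frobeniusTrace_of_check [Fact c.p.Prime] [(e.baseChange ℚ).IsGloballyMinimal] :
    (e.baseChange ℚ).frobeniusTrace c.p = c.ap := by
  rw [frobeniusTrace_baseChange_int _ (card_of_check h)]
  have := count_eq_of_check h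
  omega

/-- A checking cell's prime is good ORDINARY for `e ⊗ ℚ`. [cite: SilvermanAEC2009, VII.1 Remark 1.1] -/
theorem isOrdinaryAt_of_check [Fact c.p.Prime] [(e.baseChange ℚ).IsGloballyMinimal] :
    IsOrdinaryAt (e.baseChange ℚ) c.p := by
  refine isOrdinaryAt_baseChange_int_of_card c.p e (not_dvd_Δ_of_check h) (card_of_check h) ?_
  rw [← frobeniusTrace_baseChange_int _ (card_of_check h), frobeniusTrace_of_check h]
  exact not_dvd_ap_of_check h

end Soundness

end AtlasCell

/-! ### One curve: census row, minimality bound, cells -/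

/-- A curve of the atlas: its rank-2 census row (verbatim `Rank2Row`: label, model, conductor, listed
generators), a bound `B` for the finite global-minimality criterion, and its certified cells.
[cite: CremonaAlgorithms1997, §2.13] -/
structure AtlasCurve where
  /-- the census row (`Rank2ObservatoryRank2Rows*.lean`, verbatim) -/
  row : Rank2Row
  /-- minimality bound: `|Δ| < B¹²` and `q¹² ∤ Δ ∨ q ∤ c₄` for every `q < B` -/
  B : ℕ
  /-- the two-engine cells of the curve -/
  cells : List AtlasCell

namespace AtlasCurve

variable (C : AtlasCurve)

/-- The integer model of the row. [folklore] -/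
def e : WeierstrassCurve ℤ := ⟨C.row.a₁, C.row.a₂, C.row.a₃, C.row.a₄, C.row.a₆⟩

/-- **The kernel test of a curve**: `Δ ≠ 0` and every cell checks against the integer model. [folklore] -/
def check : Bool :=
  decide (C.e.Δ ≠ 0) && C.cells.all fun c => c.check C.e

/-- **The finite global-minimality criterion** (`forall_not_pow_dvd_or_of_bound`, tested for ALL
`q < B`, which implies it for the primes `q < B`). [cite: SilvermanAEC2009, VII.1 Remark 1.1] -/
def minCheck : Bool :=
  decide (C.e.Δ ≠ 0) && decide (C.e.Δ.natAbs < C.B ^ 12) &&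
    (List.range C.B).all fun q =>
      decide (q < 2) || !decide (q ^ 12 ∣ C.e.Δ.natAbs) || !decide (q ∣ C.e.c₄.natAbs)

/-- The base change of the integer model is the census row's curve. [folklore] -/
theorem baseChange_e : C.e.baseChange ℚ = C.row.curve := by
  ext <;> simp [e, Rank2Row.curve, WeierstrassCurve.baseChange]

variable {C}

/-- A checking curve is elliptic. [folklore] -/
theorem isElliptic (h : C.check = true) : (C.e.baseChange ℚ).IsElliptic := by
  simp only [check, Bool.and_eq_true, decide_eq_true_eq] at h
  exact isElliptic_baseChange_int _ h.1

/-- A curve passing the finite criterion has a globally minimal integer model.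
[cite: SilvermanAEC2009, VII.1 Remark 1.1] -/
theorem isGloballyMinimal (h : C.minCheck = true) : (C.e.baseChange ℚ).IsGloballyMinimal := by
  simp only [minCheck, Bool.and_eq_true, decide_eq_true_eq, List.all_eq_true, List.mem_range,
    Bool.or_eq_true, Bool.not_eq_true', decide_eq_false_iff_not] at h
  obtain ⟨⟨hΔ, hB⟩, hq⟩ := h
  refine isGloballyMinimal_baseChange_int _ <| forall_not_pow_dvd_or_of_bound _ hB hΔ fun q hq' hprime => ?_
  rcases hq q (Finset.mem_range.mp hq') with (hlt | h12) | h1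
  · exact absurd hlt (not_lt.mpr hprime.two_le)
  · exact Or.inl h12
  · exact Or.inr h1

/-- Every cell of a checking curve checks. [folklore] -/
theorem cell_check (h : C.check = true) {c : AtlasCell} (hc : c ∈ C.cells) : c.check C.e = true := by
  simp only [check, Bool.and_eq_true, List.all_eq_true] at h
  exact h.2 c hc

/-- The prime of a cell of a checking curve is prime (the `Fact` the row statement needs). [folklore] -/
theorem prime_of_mem (h : C.check = true) {c : AtlasCell} (hc : c ∈ C.cells) : c.p.Prime :=
  AtlasCell.prime_of_check (cell_check h hc)

/-- **The `p`-adic row of an atlas cell.** For a checking curve `C` and a cell `c ∈ C.cells`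
(`p = c.p`): GIVEN `hPRS` (Perrin-Riou–Schneider, BMS Thm. 1.7), `hkato` (Kato Thm. 17.4 for all
cyclotomic data), the newform `hf`, the census rank certificate `hlow : 2 ≤ rank row.curve`, and the
symbol DATA `hint`/`htab` (the plus symbols of `f` are `p`-integral; the tabulated numerators are
`D·[u/p^{n+1}]⁺` and `D·[u/p^n]⁺` at the unit residues, `‖D‖_p = 1`), the kernel-checked Riemann sum
gives `[T²] L_p ≠ 0`, hence `rank = 2`, `ord_{T=0} L_p = 2`, `Ш[p^∞]` finite, Schneider
non-degeneracy at `p` for every canonical height datum, `corank Sel_{p^∞} = 2`.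
[cite: BalakrishnanMullerStein2015, Thm. 1.7] [cite: Kato2004Asterisque, Thm. 17.4 (p. 273)]
[cite: MazurTateTeitelbaum1986Invent, §I.10–I.13] -/
theorem padicRow (h : C.check = true) {c : AtlasCell} (hc : c ∈ C.cells) [Fact c.p.Prime]
    [(C.e.baseChange ℚ).IsElliptic] [(C.e.baseChange ℚ).IsGloballyMinimal]
    (hPRS : Schneider1985_order_charGenerator) {N : ℕ} [NeZero N] {f : CuspForm (Gamma0 N) 2}
    (hf : IsNewformOf (C.e.baseChange ℚ) f)
    (hkato : ∀ (κ : ZpExtension ℚ c.p) (γ : Field.absoluteGaloisGroup ℚ),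
      kato_divisibility (C.e.baseChange ℚ) c.p (κ := κ) (γ := γ) (f := f))
    (hlow : 2 ≤ C.row.curve.mordellWeilRank) (D : ℚ) (hD : ‖(D : ℚ_[c.p])‖ = 1)
    (hint : ∀ x : ℚ, ‖(ratPlusSymbol f x : ℚ_[c.p])‖ ≤ 1)
    (htab : ∀ u : ℕ, u < c.p ^ (c.n + 1) → ¬ c.p ∣ u →
      ratPlusSymbol f ((u : ℚ) / (c.p : ℚ) ^ (c.n + 1)) = (c.tabHi.getD u 0 : ℚ) / D ∧
      ratPlusSymbol f ((u : ℚ) / (c.p : ℚ) ^ c.n) = (c.tabLo.getD (u % c.p ^ c.n) 0 : ℚ) / D) :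
    C.row.curve.mordellWeilRank = 2 ∧
      (padicLFunction f (unitRoot (C.e.baseChange ℚ) c.p : ℚ_[c.p])).order = 2 ∧
      Finite (AddCommGroup.primaryComponent (C.e.baseChange ℚ).sha c.p) ∧
      (∀ Dh : PAdicHeightData (C.e.baseChange ℚ) c.p, Dh.IsCanonical → SchneiderConjecture Dh) ∧
      (C.e.baseChange ℚ).selmerCorank c.p = 2 := by
  have hk : c.check C.e = true := cell_check h hc
  have hlow' : c.certL.r ≤ (C.e.baseChange ℚ).mordellWeilRank := by
    rw [baseChange_e]; exact hlow
  have htab' : ∀ u : ℕ, u < c.p ^ (c.certL.n + 1) → ¬ c.p ∣ u →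
      ratPlusSymbol f ((u : ℚ) / (c.p : ℚ) ^ (c.certL.n + 1)) = (c.certL.tabHi.getD u 0 : ℚ) / D ∧
      ratPlusSymbol f ((u : ℚ) / (c.p : ℚ) ^ c.certL.n) = (c.certL.tabLo.getD u 0 : ℚ) / D :=
    fun u hu hpu => by
      rw [AtlasCell.certL_tabLo_getD c hu]
      exact htab u hu hpu
  obtain ⟨hr, ho, hfin, hS, hsel⟩ := padicRow_of_symbolCertL c.p hPRS (C.e.baseChange ℚ)
    (AtlasCell.five_le_of_check hk) (AtlasCell.isOrdinaryAt_of_check hk)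
    (AtlasCell.frobeniusTrace_of_check hk) hf hkato c.certL (AtlasCell.validL_of_check hk) hlow' D hD
    hint htab'
  exact ⟨by rw [← baseChange_e]; exact hr, ho, hfin, hS, hsel⟩

/-- From a table theorem `atlas.all (check ∧ minCheck) = true` to the two tests of a member.
[folklore] -/
theorem check_of_all {atlas : List AtlasCurve}
    (h : atlas.all (fun C => C.check && C.minCheck) = true) {C : AtlasCurve} (hC : C ∈ atlas) :
    C.check = true ∧ C.minCheck = true := by
  simp only [List.all_eq_true, Bool.and_eq_true] at h
  exact h C hC

/-- From a table theorem `atlas.all check = true` (tables whose minimality is left as a hypothesis)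
to the test of a member. [folklore] -/
theorem check_of_all_check {atlas : List AtlasCurve} (h : atlas.all (fun C => C.check) = true)
    {C : AtlasCurve} (hC : C ∈ atlas) : C.check = true := by
  simp only [List.all_eq_true] at h
  exact h C hC

end AtlasCurve

end Summit.BirchSwinnertonDyer.BirchSwinnertonDyer.Rank2Observatory
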